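import Literature.NumberTheory.Automorphic.CongruenceSubgroupPropertySL2Lemma5
import Literature.NumberTheory.Automorphic.CongruenceSubgroupPropertySL2AwayLemma4
import HarnessLib

/-!
# Serre's congruence subgroup property for `SL₂(ℤ[1/m])` — proofs, A-III: Vaserstein's Lemmas 5 and 2;
# `E(I₁, I₂)` is normal in `G(I₁, I₂)` over `A = ℤ[1/m]`

Topic `Literature/NumberTheory/Automorphic`; namespace `Literature.NumberTheory.Automorphic.SL2Rel.Away`.
Everything here is PROVED; no definitions, no named facts.

This file ports the `section NumberField` parts of files XII–XIII of the tree's `𝓞_F` story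
(`CongruenceSubgroupPropertySL2Lemma5.lean`, `…Lemma2.lean`) to `A = ℤ[1/m] = Localization.Away (m : ℤ)`,
`m ≥ 2`, inside `SL₂(F)` for a field of fractions `F` (`[IsFractionRing A F]`):

* **Vaserstein 1972, Lemma 5** (`s = m/2 = 1`, `ℚ` has a real place): for a unit `t`,
  `T = diag(t, t⁻¹)`, an ideal `I` and `B ∈ SL₂(A)` with off-diagonal entries in `I`,
  `T B T⁻¹ ∈ E(I, I) B E(I, I)` (`SL2Rel.Away.exists_diagHom_conj_eq`) — the tree's proof with Serre's
  Lemme 3 for `ℤ[1/m]` (`SerreSL2.Away.exists_add_mul_forall_not_dvd_orderOf`, file A-I) in place of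
  the number-field one;
* **Vaserstein 1972, Lemma 2** (= Liehl (4)): for `I ≠ 0` and `h ∈ SL₂(F)` there is `0 ≠ I' ⊆ I` with
  `A⁻¹ h A h⁻¹ ∈ E(I, I)` for all `A ∈ G(I', I')` (`SL2Rel.Away.exists_forall_relG_conj_mem`; the good `h`
  form a normal subgroup of `SL₂(F)` containing the non-central `diag(m, m⁻¹)`);
* **Corollary** (Vaserstein p. 314 = Liehl (5)): `E(I₁, I₂)` is normalised by `G(I₁, I₂)`
  (`SL2Rel.Away.conj_mem_relE_of_mem_relG`, `relE_subgroupOf_relG_normal`).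

## References

* [Vaserstein1972SL2] L. N. Vaserstein, Mat. Sb. 89 (131) (1972) 313–322, Lemmas 2 and 5, p. 314.
* [Liehl1981SL2Orders] B. Liehl, J. reine angew. Math. 323 (1981) 153–171, (4), (5).
* [SerreSL2Congruence1970] J.-P. Serre, Ann. of Math. 92 (1970), §2.2 Lemme 3; §2.6 (`K = ℚ`).
-/

open Matrix MatrixGroups

namespace Literature.NumberTheory.Automorphic

namespace SL2Rel

namespace Away

/-! ### Lemma 5 over `ℤ[1/m]` -/

section Lemma5

variable {m : ℕ}

/-- **Vaserstein 1972, Lemma 5** over `A = ℤ[1/m]` (`s = m/2 = 1`: `ℚ` has a real place): for a unit `t`,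
`T = diag(t, t⁻¹)`, an ideal `I` and `B = (a b; c d) ∈ SL₂(ℤ[1/m])` with `b, c ∈ I`:
`T B T⁻¹ ∈ E(I, I) B E(I, I)`. [cite: Vaserstein1972SL2, Lemma 5] -/
theorem exists_diagHom_conj_eq (hm : m ≠ 0) (t : (Localization.Away (m : ℤ))ˣ) {I : Ideal (Localization.Away (m : ℤ))} (B : SL(2, Localization.Away (m : ℤ)))
    (hb : B 0 1 ∈ I) (hc : B 1 0 ∈ I) :
    ∃ E₁ ∈ relE I I, ∃ E₂ ∈ relE I I, diagHom t * B * (diagHom t)⁻¹ = E₁ * B * E₂ := by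
  classical
  haveI := SL2Rel.isDomain_away hm
  by_cases hb0 : B 0 1 = 0
  · refine ⟨1, one_mem _, e21 (B 0 0 * B 1 0 * (↑t⁻¹ * ↑t⁻¹ - 1)),
      e21_mem_relE (I.mul_mem_right _ (I.mul_mem_left _ hc)), ?_⟩
    rw [one_mul, diagHom_conj_eq_of_apply_01_eq_zero t B hb0]
  -- the good exponents form a subgroup of `ℤ`
  let S : AddSubgroup ℤ :=
    { carrier := {n | ∃ E₁ ∈ relE I I, ∃ E₂ ∈ relE I I,
        diagHom (t ^ n) * B * (diagHom (t ^ n))⁻¹ = E₁ * B * E₂}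
      zero_mem' := ⟨1, one_mem _, 1, one_mem _, by simp⟩
      add_mem' := by
        rintro n m ⟨E₁, hE₁, E₂, hE₂, h₁⟩ ⟨E₃, hE₃, E₄, hE₄, h₂⟩
        refine ⟨diagHom (t ^ n) * E₃ * (diagHom (t ^ n))⁻¹ * E₁,
          mul_mem (conj_diagHom_mem_relE _ hE₃) hE₁,
          E₂ * (diagHom (t ^ n) * E₄ * (diagHom (t ^ n))⁻¹),
          mul_mem hE₂ (conj_diagHom_mem_relE _ hE₄), ?_⟩
        rw [_root_.zpow_add, map_mul]
        calc diagHom (t ^ n) * diagHom (t ^ m) * B * (diagHom (t ^ n) * diagHom (t ^ m))⁻¹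
            = diagHom (t ^ n) * (diagHom (t ^ m) * B * (diagHom (t ^ m))⁻¹) *
                (diagHom (t ^ n))⁻¹ := by group
          _ = diagHom (t ^ n) * E₃ * (diagHom (t ^ n))⁻¹ *
                (diagHom (t ^ n) * B * (diagHom (t ^ n))⁻¹) *
                (diagHom (t ^ n) * E₄ * (diagHom (t ^ n))⁻¹) := by rw [h₂]; group
          _ = _ := by rw [h₁]; group
      neg_mem' := by
        rintro n ⟨E₁, hE₁, E₂, hE₂, h⟩
        refine ⟨(diagHom (t ^ n))⁻¹ * E₁⁻¹ * diagHom (t ^ n),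
          diagHom_inv_conj_mem_relE _ (inv_mem hE₁),
          (diagHom (t ^ n))⁻¹ * E₂⁻¹ * diagHom (t ^ n),
          diagHom_inv_conj_mem_relE _ (inv_mem hE₂), ?_⟩
        rw [_root_.zpow_neg, map_inv]
        calc (diagHom (t ^ n))⁻¹ * B * (diagHom (t ^ n))⁻¹⁻¹
            = (diagHom (t ^ n))⁻¹ * E₁⁻¹ * (E₁ * B * E₂) * E₂⁻¹ * diagHom (t ^ n) := by group
          _ = (diagHom (t ^ n))⁻¹ * E₁⁻¹ * (diagHom (t ^ n) * B * (diagHom (t ^ n))⁻¹) * E₂⁻¹ *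
                diagHom (t ^ n) := by rw [h]
          _ = _ := by group }
  have hSmem : ∀ n : ℤ, n ∈ S ↔ ∃ E₁ ∈ relE I I, ∃ E₂ ∈ relE I I,
      diagHom (t ^ n) * B * (diagHom (t ^ n))⁻¹ = E₁ * B * E₂ := fun n ↦ Iff.rfl
  suffices h1 : (1 : ℤ) ∈ S by
    obtain ⟨E₁, hE₁, E₂, hE₂, h⟩ := (hSmem 1).1 h1
    exact ⟨E₁, hE₁, E₂, hE₂, by simpa using h⟩
  -- `n ∈ S` whenever `t²ⁿ ≡ 1 (mod a + x b²)`
  set a := B 0 0 with ha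
  set b := B 0 1 with hbdef
  have hstep : ∀ (x : Localization.Away (m : ℤ)) (n : ℕ),
      ((t ^ n : (Localization.Away (m : ℤ))ˣ) : Localization.Away (m : ℤ)) * ↑(t ^ n) - 1 ∈ Ideal.span {a + x * (b * b)} → (n : ℤ) ∈ S := by
    intro x n hn
    obtain ⟨r, hr⟩ := Ideal.mem_span_singleton'.1 hn
    rw [hSmem, zpow_natCast]
    exact diagHom_conj_mem_of_dvd (t ^ n) B hb hc x r (by rw [← hr, ← ha, ← hbdef]; ring)
  -- for every prime `l`, an element of `S` prime to `l`
  have hab : IsCoprime a (b * b) := (isCoprime_row B).mul_right (isCoprime_row B)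
  have hprime : ∀ l : ℕ, l.Prime → ∃ n : ℕ, n ≠ 0 ∧ ¬ l ∣ n ∧ (n : ℤ) ∈ S := by
    intro l hl
    obtain ⟨x, -, hx⟩ := SerreSL2.Away.exists_add_mul_forall_not_dvd_orderOf hm hab
      (mul_ne_zero hb0 hb0) hl
    set J : Ideal (Localization.Away (m : ℤ)) := Ideal.span {a + x * (b * b)} with hJ
    set u : (Localization.Away (m : ℤ) ⧸ J)ˣ := Units.map (Ideal.Quotient.mk J : Localization.Away (m : ℤ) →* Localization.Away (m : ℤ) ⧸ J) t with hu
    have hΦ := hx u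
    set Φ := orderOf u with hΦdef
    have hΦ0 : Φ ≠ 0 := fun h ↦ hΦ (by rw [h]; exact dvd_zero _)
    have hpow : ∀ N : ℕ, Φ ∣ N → ((t ^ N : (Localization.Away (m : ℤ))ˣ) : Localization.Away (m : ℤ)) - 1 ∈ J := by
      intro N hN
      have h1 : u ^ N = 1 := orderOf_dvd_iff_pow_eq_one.1 hN
      have h2 := congrArg (fun w : (Localization.Away (m : ℤ) ⧸ J)ˣ ↦ (w : Localization.Away (m : ℤ) ⧸ J)) h1
      simp only [hu, Units.val_pow_eq_pow_val, Units.coe_map, MonoidHom.coe_coe, Units.val_one,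
        ← map_pow] at h2
      rw [← (Ideal.Quotient.mk J).map_one, Ideal.Quotient.eq] at h2
      rwa [Units.val_pow_eq_pow_val]
    -- `n = Φ/2` or `Φ`
    by_cases heven : 2 ∣ Φ
    · obtain ⟨n, hn⟩ := heven
      refine ⟨n, fun h ↦ hΦ0 (by rw [hn, h, mul_zero]), fun hln ↦ hΦ ?_, hstep x n ?_⟩
      · rcases eq_or_ne l 2 with rfl | hl2
        · rw [hn, show padicValNat 2 2 + 1 = 2 by norm_num, pow_two]
          exact mul_dvd_mul_left 2 hln
        · rw [padicValNat.eq_zero_of_not_dvd (fun h ↦ hl2 ((Nat.prime_dvd_prime_iff_eq hl Nat.prime_two).1 h)),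
            zero_add, pow_one, hn]
          exact dvd_mul_of_dvd_right hln 2
      · rw [← Units.val_mul, ← pow_add, ← two_mul, ← hn]
        exact hpow Φ dvd_rfl
    · refine ⟨Φ, hΦ0, fun hlΦ ↦ ?_, hstep x Φ ?_⟩
      · rcases eq_or_ne l 2 with rfl | hl2
        · exact heven hlΦ
        · apply hΦ
          rwa [padicValNat.eq_zero_of_not_dvd (fun h ↦ hl2 ((Nat.prime_dvd_prime_iff_eq hl Nat.prime_two).1 h)),
            zero_add, pow_one]
      · rw [← Units.val_mul, ← pow_add]
        exact hpow (Φ + Φ) (dvd_add dvd_rfl dvd_rfl)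
  -- hence `S = ℤ`
  set S' : Submodule ℤ ℤ := AddSubgroup.toIntSubmodule S with hS'
  haveI : S'.IsPrincipal := IsPrincipalIdealRing.principal S'
  set g : ℤ := Submodule.IsPrincipal.generator S' with hg
  have hgS : g ∈ S := Submodule.IsPrincipal.generator_mem S'
  have hgdvd : ∀ n : ℤ, n ∈ S → g ∣ n := fun n hn ↦
    (Submodule.IsPrincipal.mem_iff_generator_dvd S').1 hn
  have hg1 : g.natAbs = 1 := by
    by_contra hne
    obtain ⟨l, hl, hlg⟩ := Nat.exists_prime_and_dvd hne
    obtain ⟨n, -, hln, hnS⟩ := hprime l hl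
    refine hln ?_
    have := (Int.natAbs_dvd_natAbs.2 (hgdvd n hnS))
    rw [Int.natAbs_natCast] at this
    exact hlg.trans this
  rcases Int.natAbs_eq g with h | h
  · rw [hg1] at h; rw [← show g = 1 from h]; exact hgS
  · rw [hg1] at h
    have : (1 : ℤ) = -g := by rw [h]; ring
    rw [this]; exact S.neg_mem hgS


end Lemma5

/-! ### Lemma 2 over `ℤ[1/m]` -/

section Lemma2

variable {m : ℕ} {F : Type*} [Field F] [Algebra (Localization.Away (m : ℤ)) F]
  [IsFractionRing (Localization.Away (m : ℤ)) F]

/-- **The main step of Lemma 2** (Vaserstein p. 319, with `s = 1`): for `g = diag(t, t⁻¹)`, `t` a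
unit, `I ≠ 0` and `A ∈ G(I, I)`: `A⁻¹ g A g⁻¹ ∈ E(I, I)`. [cite: Vaserstein1972SL2, Lemma 2 (proof)] -/
theorem conj_diagHom_mem_relE_of_mem_relG (hm : 2 ≤ m) (t : (Localization.Away (m : ℤ))ˣ) {I : Ideal (Localization.Away (m : ℤ))}
    (hI : I ≠ ⊥) {A : SL(2, Localization.Away (m : ℤ))} (hA : A ∈ relG I I) :
    A⁻¹ * diagHom t * A * (diagHom t)⁻¹ ∈ relE I I := by
  have hm0 : m ≠ 0 := by omega
  haveI := SL2Rel.isDomain_away hm0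
  haveI := SL2Rel.isDedekindDomain_away hm0
  have hinj := map_injective (algebraMap (Localization.Away (m : ℤ)) (FractionRing (Localization.Away (m : ℤ)))) (IsFractionRing.injective (Localization.Away (m : ℤ)) (FractionRing (Localization.Away (m : ℤ))))
  -- Lemma 4 for `A⁻¹`: `A⁻¹ E(I'', I'') A ⊆ E(I, I)`, and we may assume `I'' ⊆ I`
  obtain ⟨I'', hI'', h4⟩ := exists_conj_relE_le hm
    (SpecialLinearGroup.map (algebraMap (Localization.Away (m : ℤ)) (FractionRing (Localization.Away (m : ℤ)))) A⁻¹) hI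
  set I₀ : Ideal (Localization.Away (m : ℤ)) := I'' * I with hI₀
  have hI₀0 : I₀ ≠ ⊥ := mul_ne_zero hI'' hI
  have hI₀I : I₀ ≤ I := Ideal.mul_le_left
  have h4' : ∀ M ∈ relE I₀ I₀, A⁻¹ * M * A ∈ relE I I := by
    intro M hM
    obtain ⟨E, hE, hEq⟩ := h4 M (relE_mono Ideal.mul_le_right Ideal.mul_le_right hM)
    rw [← map_inv, ← map_mul, ← map_mul, inv_inv] at hEq
    rwa [← hinj hEq]
  -- Lemma 1: `B = AE ∈ G(I₀, I₀)`; Lemma 5: `g B g⁻¹ = E₁ B E₂`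
  obtain ⟨E, hE, hB⟩ := exists_mul_relE_mem_relG hI₀0 hI₀I hA
  obtain ⟨E₁, hE₁, E₂, hE₂, h5⟩ := exists_diagHom_conj_eq hm0 t (A * E) hB.1 hB.2.1
  have key : A⁻¹ * diagHom t * A * (diagHom t)⁻¹ =
      (A⁻¹ * E₁ * A) * E * E₂ * (diagHom t * E⁻¹ * (diagHom t)⁻¹) := by
    calc A⁻¹ * diagHom t * A * (diagHom t)⁻¹
        = A⁻¹ * (diagHom t * (A * E) * (diagHom t)⁻¹) * (diagHom t * E⁻¹ * (diagHom t)⁻¹) := by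
          group
      _ = _ := by rw [h5]; group
  rw [key]
  exact mul_mem (mul_mem (mul_mem (h4' E₁ hE₁) hE) (relE_mono hI₀I hI₀I hE₂))
    (conj_diagHom_mem_relE t (inv_mem hE))

/-! Below, "Lemma 2 holds for `h`" (principal-congruence form) means: for every ideal `I ≠ 0`
there is an ideal `I' ≠ 0` with `A⁻¹ h A h⁻¹ ∈ E(I, I)` (inside `SL₂(F)`) for all `A ∈ Γ(I')`; we
spell this out in each statement. -/

omit [IsFractionRing (Localization.Away (m : ℤ)) F] in
/-- Lemma 2 holds for `1`. [cite: Vaserstein1972SL2, Lemma 2 (proof)] -/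
theorem lemma2_one :
    ∀ I : Ideal (Localization.Away (m : ℤ)), I ≠ ⊥ → ∃ I' : Ideal (Localization.Away (m : ℤ)), I' ≠ ⊥ ∧ ∀ A ∈ Gamma I',
      (SpecialLinearGroup.map (algebraMap (Localization.Away (m : ℤ)) F) A)⁻¹ * (1 : SL(2, F)) *
          SpecialLinearGroup.map (algebraMap (Localization.Away (m : ℤ)) F) A * (1 : SL(2, F))⁻¹ ∈
        (relE I I).map (SpecialLinearGroup.map (algebraMap (Localization.Away (m : ℤ)) F)) := fun I hI ↦
  ⟨I, hI, fun A _ ↦ by simp⟩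

omit [IsFractionRing (Localization.Away (m : ℤ)) F] in
/-- Lemma 2 holds for `diag(t, t⁻¹)`, `t` a unit (with `I' = I²`, as `Γ(I²) ⊆ G(I, I)`).
[cite: Vaserstein1972SL2, Lemma 2 (proof)] -/
theorem lemma2_diagHom (hm : 2 ≤ m) (t : (Localization.Away (m : ℤ))ˣ) :
    ∀ I : Ideal (Localization.Away (m : ℤ)), I ≠ ⊥ → ∃ I' : Ideal (Localization.Away (m : ℤ)), I' ≠ ⊥ ∧ ∀ A ∈ Gamma I',
      (SpecialLinearGroup.map (algebraMap (Localization.Away (m : ℤ)) F) A)⁻¹ * SpecialLinearGroup.map (algebraMap (Localization.Away (m : ℤ)) F) (diagHom t) *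
          SpecialLinearGroup.map (algebraMap (Localization.Away (m : ℤ)) F) A * (SpecialLinearGroup.map (algebraMap (Localization.Away (m : ℤ)) F) (diagHom t))⁻¹ ∈
        (relE I I).map (SpecialLinearGroup.map (algebraMap (Localization.Away (m : ℤ)) F)) := by
  haveI := SL2Rel.isDomain_away (show m ≠ 0 by omega)
  intro I hI
  refine ⟨I * I, mul_ne_zero hI hI, fun A hA ↦ ?_⟩
  rw [← map_inv, ← map_mul, ← map_mul, ← map_inv, ← map_mul]
  exact Subgroup.mem_map_of_mem _
    (conj_diagHom_mem_relE_of_mem_relG hm t hI (Gamma_mul_self_le_relG I hA))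

/-- Lemma 2 is stable under products (uses Lemma 4 for `h₁`). [cite: Vaserstein1972SL2, Lemma 2 (proof)] -/
theorem lemma2_mul (hm : 2 ≤ m) {h₁ h₂ : SL(2, F)}
    (hh₁ : ∀ I : Ideal (Localization.Away (m : ℤ)), I ≠ ⊥ → ∃ I' : Ideal (Localization.Away (m : ℤ)), I' ≠ ⊥ ∧ ∀ A ∈ Gamma I',
        (SpecialLinearGroup.map (algebraMap (Localization.Away (m : ℤ)) F) A)⁻¹ * h₁ *
            SpecialLinearGroup.map (algebraMap (Localization.Away (m : ℤ)) F) A * h₁⁻¹ ∈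
          (relE I I).map (SpecialLinearGroup.map (algebraMap (Localization.Away (m : ℤ)) F)))
    (hh₂ : ∀ I : Ideal (Localization.Away (m : ℤ)), I ≠ ⊥ → ∃ I' : Ideal (Localization.Away (m : ℤ)), I' ≠ ⊥ ∧ ∀ A ∈ Gamma I',
        (SpecialLinearGroup.map (algebraMap (Localization.Away (m : ℤ)) F) A)⁻¹ * h₂ *
            SpecialLinearGroup.map (algebraMap (Localization.Away (m : ℤ)) F) A * h₂⁻¹ ∈
          (relE I I).map (SpecialLinearGroup.map (algebraMap (Localization.Away (m : ℤ)) F))) :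
    ∀ I : Ideal (Localization.Away (m : ℤ)), I ≠ ⊥ → ∃ I' : Ideal (Localization.Away (m : ℤ)), I' ≠ ⊥ ∧ ∀ A ∈ Gamma I',
      (SpecialLinearGroup.map (algebraMap (Localization.Away (m : ℤ)) F) A)⁻¹ * (h₁ * h₂) *
          SpecialLinearGroup.map (algebraMap (Localization.Away (m : ℤ)) F) A * (h₁ * h₂)⁻¹ ∈
        (relE I I).map (SpecialLinearGroup.map (algebraMap (Localization.Away (m : ℤ)) F)) := by
  haveI := SL2Rel.isDomain_away (show m ≠ 0 by omega)
  intro I hI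
  obtain ⟨I₃, hI₃, h3⟩ := exists_conj_relE_le hm h₁ hI
  obtain ⟨I₁', hI₁', hA₁⟩ := hh₁ I hI
  obtain ⟨I₂', hI₂', hA₂⟩ := hh₂ I₃ hI₃
  refine ⟨I₁' * I₂', mul_ne_zero hI₁' hI₂', fun A hA ↦ ?_⟩
  set a := SpecialLinearGroup.map (algebraMap (Localization.Away (m : ℤ)) F) A with ha
  have e : a⁻¹ * (h₁ * h₂) * a * (h₁ * h₂)⁻¹ =
      (a⁻¹ * h₁ * a * h₁⁻¹) * (h₁ * (a⁻¹ * h₂ * a * h₂⁻¹) * h₁⁻¹) := by group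
  rw [e]
  refine mul_mem (hA₁ A (Gamma_mono Ideal.mul_le_right hA)) ?_
  obtain ⟨M, hM, hMeq⟩ := Subgroup.mem_map.1 (hA₂ A (Gamma_mono Ideal.mul_le_left hA))
  obtain ⟨E, hE, hEeq⟩ := h3 M hM
  rw [← hMeq, ← hEeq]
  exact Subgroup.mem_map_of_mem _ hE

/-- Lemma 2 is stable under inverses (uses Lemma 4 for `h⁻¹`). [cite: Vaserstein1972SL2, Lemma 2 (proof)] -/
theorem lemma2_inv (hm : 2 ≤ m) {h : SL(2, F)}
    (hh : ∀ I : Ideal (Localization.Away (m : ℤ)), I ≠ ⊥ → ∃ I' : Ideal (Localization.Away (m : ℤ)), I' ≠ ⊥ ∧ ∀ A ∈ Gamma I',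
        (SpecialLinearGroup.map (algebraMap (Localization.Away (m : ℤ)) F) A)⁻¹ * h *
            SpecialLinearGroup.map (algebraMap (Localization.Away (m : ℤ)) F) A * h⁻¹ ∈
          (relE I I).map (SpecialLinearGroup.map (algebraMap (Localization.Away (m : ℤ)) F))) :
    ∀ I : Ideal (Localization.Away (m : ℤ)), I ≠ ⊥ → ∃ I' : Ideal (Localization.Away (m : ℤ)), I' ≠ ⊥ ∧ ∀ A ∈ Gamma I',
      (SpecialLinearGroup.map (algebraMap (Localization.Away (m : ℤ)) F) A)⁻¹ * h⁻¹ *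
          SpecialLinearGroup.map (algebraMap (Localization.Away (m : ℤ)) F) A * h⁻¹⁻¹ ∈
        (relE I I).map (SpecialLinearGroup.map (algebraMap (Localization.Away (m : ℤ)) F)) := by
  intro I hI
  obtain ⟨I₃, hI₃, h3⟩ := exists_conj_relE_le hm h⁻¹ hI
  obtain ⟨I', hI', hA⟩ := hh I₃ hI₃
  refine ⟨I', hI', fun A hAm ↦ ?_⟩
  set a := SpecialLinearGroup.map (algebraMap (Localization.Away (m : ℤ)) F) A with ha
  have e : a⁻¹ * h⁻¹ * a * h⁻¹⁻¹ = h⁻¹ * (a⁻¹ * h * a * h⁻¹)⁻¹ * h⁻¹⁻¹ := by group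
  rw [e]
  obtain ⟨M, hM, hMeq⟩ := Subgroup.mem_map.1 (hA A hAm)
  obtain ⟨E, hE, hEeq⟩ := h3 M⁻¹ (inv_mem hM)
  rw [← hMeq, ← map_inv, ← hEeq]
  exact Subgroup.mem_map_of_mem _ hE

/-- Lemma 2 is stable under conjugation (uses Lemma 4 for `k` and `k⁻¹ Γ(J') k ⊆ Γ(J)`).
[cite: Vaserstein1972SL2, Lemma 2 (proof)] -/
theorem lemma2_conj (hm : 2 ≤ m) {h : SL(2, F)}
    (hh : ∀ I : Ideal (Localization.Away (m : ℤ)), I ≠ ⊥ → ∃ I' : Ideal (Localization.Away (m : ℤ)), I' ≠ ⊥ ∧ ∀ A ∈ Gamma I',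
        (SpecialLinearGroup.map (algebraMap (Localization.Away (m : ℤ)) F) A)⁻¹ * h *
            SpecialLinearGroup.map (algebraMap (Localization.Away (m : ℤ)) F) A * h⁻¹ ∈
          (relE I I).map (SpecialLinearGroup.map (algebraMap (Localization.Away (m : ℤ)) F)))
    (k : SL(2, F)) :
    ∀ I : Ideal (Localization.Away (m : ℤ)), I ≠ ⊥ → ∃ I' : Ideal (Localization.Away (m : ℤ)), I' ≠ ⊥ ∧ ∀ A ∈ Gamma I',
      (SpecialLinearGroup.map (algebraMap (Localization.Away (m : ℤ)) F) A)⁻¹ * (k * h * k⁻¹) *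
          SpecialLinearGroup.map (algebraMap (Localization.Away (m : ℤ)) F) A * (k * h * k⁻¹)⁻¹ ∈
        (relE I I).map (SpecialLinearGroup.map (algebraMap (Localization.Away (m : ℤ)) F)) := by
  haveI := SL2Rel.isDomain_away (show m ≠ 0 by omega)
  intro I hI
  obtain ⟨I₃, hI₃, h3⟩ := exists_conj_relE_le hm k hI
  obtain ⟨J, hJ, hA⟩ := hh I₃ hI₃
  obtain ⟨J', hJ', -, hΓ⟩ := exists_conj_Gamma k⁻¹ hJ
  refine ⟨J', hJ', fun A hAm ↦ ?_⟩
  obtain ⟨B, hB, hBeq⟩ := hΓ A hAm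
  rw [inv_inv] at hBeq
  set a := SpecialLinearGroup.map (algebraMap (Localization.Away (m : ℤ)) F) A with ha
  set b := SpecialLinearGroup.map (algebraMap (Localization.Away (m : ℤ)) F) B with hb
  have e : a⁻¹ * (k * h * k⁻¹) * a * (k * h * k⁻¹)⁻¹ =
      k * ((k⁻¹ * a * k)⁻¹ * h * (k⁻¹ * a * k) * h⁻¹) * k⁻¹ := by group
  rw [e, ← hBeq]
  obtain ⟨M, hM, hMeq⟩ := Subgroup.mem_map.1 (hA B hB)
  obtain ⟨E, hE, hEeq⟩ := h3 M hM
  rw [← hMeq, ← hEeq]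
  exact Subgroup.mem_map_of_mem _ hE

/-- **Vaserstein 1972, Lemma 2**, principal-congruence form, for every `h ∈ SL₂(F)`, `A = ℤ[1/m]`: the `h` for
which it holds form a normal subgroup of `SL₂(F)` containing the non-central `diag(v, v⁻¹)`, `v = m` a
unit of infinite order, hence everything. [cite: Vaserstein1972SL2, Lemma 2] -/
theorem lemma2 (hm : 2 ≤ m) (h : SL(2, F)) :
    ∀ I : Ideal (Localization.Away (m : ℤ)), I ≠ ⊥ → ∃ I' : Ideal (Localization.Away (m : ℤ)), I' ≠ ⊥ ∧ ∀ A ∈ Gamma I',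
      (SpecialLinearGroup.map (algebraMap (Localization.Away (m : ℤ)) F) A)⁻¹ * h *
          SpecialLinearGroup.map (algebraMap (Localization.Away (m : ℤ)) F) A * h⁻¹ ∈
        (relE I I).map (SpecialLinearGroup.map (algebraMap (Localization.Away (m : ℤ)) F)) := by
  haveI := SL2Rel.isDomain_away (show m ≠ 0 by omega)
  -- the subgroup of good `h`
  let S : Subgroup SL(2, F) :=
    { carrier := {h | ∀ I : Ideal (Localization.Away (m : ℤ)), I ≠ ⊥ → ∃ I' : Ideal (Localization.Away (m : ℤ)), I' ≠ ⊥ ∧ ∀ A ∈ Gamma I',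
          (SpecialLinearGroup.map (algebraMap (Localization.Away (m : ℤ)) F) A)⁻¹ * h *
              SpecialLinearGroup.map (algebraMap (Localization.Away (m : ℤ)) F) A * h⁻¹ ∈
            (relE I I).map (SpecialLinearGroup.map (algebraMap (Localization.Away (m : ℤ)) F))}
      one_mem' := lemma2_one
      mul_mem' := fun h₁ h₂ ↦ lemma2_mul hm h₁ h₂
      inv_mem' := fun h ↦ lemma2_inv hm h }
  haveI : S.Normal := ⟨fun _ hh k ↦ lemma2_conj hm hh k⟩
  have hm0 : m ≠ 0 := by omega
  have h2 : ∃ a : F, a ≠ 0 ∧ a ^ 2 ≠ 1 := by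
    refine ⟨algebraMap (Localization.Away (m : ℤ)) F (m : ℕ), ?_, ?_⟩
    · exact fun h ↦ natCast_ne_zero_away hm0 hm0
        (IsFractionRing.injective (Localization.Away (m : ℤ)) F (by rw [h, map_zero]))
    · intro h
      have h1 : ((m : ℕ) : Localization.Away (m : ℤ)) ^ 2 = 1 :=
        IsFractionRing.injective (Localization.Away (m : ℤ)) F (by rw [map_pow, h, map_one])
      have h3 : ((m : ℤ) ^ 2 : ℤ) = 1 := by
        apply algebraMap_int_away_injective hm0
        simpa using h1
      have h4 : m ^ 2 = 1 := by exact_mod_cast h3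
      rcases Nat.pow_eq_one.1 h4 with h5 | h5 <;> omega
  rcases normal_le_center_or_eq_top h2 S with hle | htop
  · -- `diag(v, v⁻¹)` with `v` of infinite order satisfies Lemma 2 but is not central
    exfalso
    obtain ⟨v, hv⟩ := SerreSL2.Away.exists_unit_pow_ne_one hm
    have hmem := hle (lemma2_diagHom hm v : _ ∈ S)
    rw [Subgroup.mem_center_iff] at hmem
    have h01 := congrArg (fun M : SL(2, F) ↦ M 0 1) (hmem (e12 1))
    simp only [mul_apply_two, map_apply_two, diagHom_apply_00, diagHom_apply_01,
      diagHom_apply_11, e12_apply_00, e12_apply_01, e12_apply_11, map_zero,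
      mul_zero, add_zero, one_mul, mul_one, zero_add] at h01
    -- `h01 : algebraMap v⁻¹ = algebraMap v`, so `v² = 1`
    apply hv 2 two_ne_zero
    have h' : ((v⁻¹ : (Localization.Away (m : ℤ))ˣ) : Localization.Away (m : ℤ)) = v := IsFractionRing.injective (Localization.Away (m : ℤ)) F h01
    refine Units.ext ?_
    rw [Units.val_pow_eq_pow_val, pow_two, Units.val_one]
    calc (v : Localization.Away (m : ℤ)) * v = v * ↑v⁻¹ := by rw [h']
      _ = 1 := v.mul_inv
  · have : h ∈ S := by rw [htop]; exact Subgroup.mem_top h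
    exact this

/-- **Vaserstein 1972, Lemma 2** (= Liehl 1981, (4)) over `A = ℤ[1/m]`: for every ideal `I ≠ 0` and every
`h ∈ SL₂(F)` there is an ideal `0 ≠ I' ⊆ I` with `A⁻¹ h A h⁻¹ ∈ E(I, I)` for all `A ∈ G(I', I')`
(`m ≥ 2`; inside `SL₂` of the field of fractions). [cite: Vaserstein1972SL2, Lemma 2] -/
theorem exists_forall_relG_conj_mem (hm : 2 ≤ m) (h : SL(2, F)) {I : Ideal (Localization.Away (m : ℤ))}
    (hI : I ≠ ⊥) : ∃ I' : Ideal (Localization.Away (m : ℤ)), I' ≠ ⊥ ∧ I' ≤ I ∧ ∀ A ∈ relG I' I',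
      (SpecialLinearGroup.map (algebraMap (Localization.Away (m : ℤ)) F) A)⁻¹ * h *
          SpecialLinearGroup.map (algebraMap (Localization.Away (m : ℤ)) F) A * h⁻¹ ∈
        (relE I I).map (SpecialLinearGroup.map (algebraMap (Localization.Away (m : ℤ)) F)) := by
  haveI := SL2Rel.isDedekindDomain_away (show m ≠ 0 by omega)
  haveI := SL2Rel.isDomain_away (show m ≠ 0 by omega)
  obtain ⟨I₃, hI₃, h3⟩ := exists_conj_relE_le hm h hI
  obtain ⟨I₅, hI₅, h5⟩ := lemma2 hm h I hI
  set I' : Ideal (Localization.Away (m : ℤ)) := I₃ * I * I₅ with hI'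
  have hI'0 : I' ≠ ⊥ := mul_ne_zero (mul_ne_zero hI₃ hI) hI₅
  have hI'I : I' ≤ I := Ideal.mul_le_right.trans Ideal.mul_le_left
  have hI'3 : I' ≤ I₃ := Ideal.mul_le_right.trans Ideal.mul_le_right
  have hI'5 : I' ≤ I₅ := Ideal.mul_le_left
  refine ⟨I', hI'0, hI'I, fun A hA ↦ ?_⟩
  -- Lemma 1: `A = C E⁻¹`, `C ∈ Γ(I')`, `E ∈ E(I', I')`
  obtain ⟨E, hE, hC⟩ := exists_mul_relE_mem_Gamma hI'0 le_rfl hA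
  set a := SpecialLinearGroup.map (algebraMap (Localization.Away (m : ℤ)) F) A with ha
  set c := SpecialLinearGroup.map (algebraMap (Localization.Away (m : ℤ)) F) (A * E) with hc
  set e := SpecialLinearGroup.map (algebraMap (Localization.Away (m : ℤ)) F) E with he
  have hae : a = c * e⁻¹ := by rw [hc, map_mul, ← ha, ← he, mul_inv_cancel_right]
  have eq : a⁻¹ * h * a * h⁻¹ = e * (c⁻¹ * h * c * h⁻¹) * (h * e⁻¹ * h⁻¹) := by
    rw [hae]; group
  rw [eq]
  refine mul_mem (mul_mem (Subgroup.mem_map_of_mem _ (relE_mono hI'I hI'I hE)) ?_) ?_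
  · exact h5 (A * E) (Gamma_mono hI'5 hC)
  · obtain ⟨E', hE', hEq'⟩ := h3 E⁻¹ (relE_mono hI'3 hI'3 (inv_mem hE))
    rw [he, ← map_inv, ← hEq']
    exact Subgroup.mem_map_of_mem _ hE'

/-- **`E(I₁, I₂)` is normalised by `G(I₁, I₂)`** (Vaserstein p. 314, from Lemmas 1 and 2; = Liehl
1981, (5)), for non-zero ideals of the integers of a number field with a real place and a unit of
infinite order. [cite: Vaserstein1972SL2, p. 314] -/
theorem conj_mem_relE_of_mem_relG (hm : 2 ≤ m) {I₁ I₂ : Ideal (Localization.Away (m : ℤ))} (hI₁ : I₁ ≠ ⊥)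
    (hI₂ : I₂ ≠ ⊥) {A : SL(2, Localization.Away (m : ℤ))} (hA : A ∈ relG I₁ I₂) {M : SL(2, Localization.Away (m : ℤ))}
    (hM : M ∈ relE I₁ I₂) : A⁻¹ * M * A ∈ relE I₁ I₂ := by
  haveI := SL2Rel.isDedekindDomain_away (show m ≠ 0 by omega)
  haveI := SL2Rel.isDomain_away (show m ≠ 0 by omega)
  have hinj := map_injective (algebraMap (Localization.Away (m : ℤ)) (FractionRing (Localization.Away (m : ℤ)))) (IsFractionRing.injective (Localization.Away (m : ℤ)) (FractionRing (Localization.Away (m : ℤ))))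
  set I : Ideal (Localization.Away (m : ℤ)) := I₁ * I₂ with hIdef
  have hI : I ≠ ⊥ := mul_ne_zero hI₁ hI₂
  have hEI : relE I I ≤ relE I₁ I₂ := relE_mono Ideal.mul_le_right Ideal.mul_le_left
  -- conjugates of the generators
  have hgen : ∀ g ∈ relE I₁ I₂, (∀ B : SL(2, Localization.Away (m : ℤ)), B⁻¹ * g * B = B⁻¹ * g * B) →
      ∀ I' : Ideal (Localization.Away (m : ℤ)), I' ≠ ⊥ → I' ≤ I →
      (∀ B ∈ relG I' I', (SpecialLinearGroup.map (algebraMap (Localization.Away (m : ℤ)) (FractionRing (Localization.Away (m : ℤ)))) B)⁻¹ *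
          SpecialLinearGroup.map (algebraMap (Localization.Away (m : ℤ)) (FractionRing (Localization.Away (m : ℤ)))) g *
          SpecialLinearGroup.map (algebraMap (Localization.Away (m : ℤ)) (FractionRing (Localization.Away (m : ℤ)))) B *
          (SpecialLinearGroup.map (algebraMap (Localization.Away (m : ℤ)) (FractionRing (Localization.Away (m : ℤ)))) g)⁻¹ ∈
        (relE I I).map (SpecialLinearGroup.map (algebraMap (Localization.Away (m : ℤ)) (FractionRing (Localization.Away (m : ℤ)))))) →
      A⁻¹ * g * A ∈ relE I₁ I₂ := by
    intro g hg _ I' hI' hI'I hB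
    -- Lemma 1: `B = AE ∈ G(I', I')`
    obtain ⟨E, hE, hBm⟩ := exists_mul_relE_mem_relG hI' (hI'I.trans Ideal.mul_le_right) hA
    obtain ⟨N, hN, hNeq⟩ := Subgroup.mem_map.1 (hB (A * E) hBm)
    rw [← map_inv, ← map_mul, ← map_mul, ← map_inv, ← map_mul] at hNeq
    have hN' : (A * E)⁻¹ * g * (A * E) * g⁻¹ ∈ relE I₁ I₂ := by rw [← hinj hNeq]; exact hEI hN
    have e : A⁻¹ * g * A = E * ((A * E)⁻¹ * g * (A * E) * g⁻¹) * g * E⁻¹ := by group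
    rw [e]
    exact mul_mem (mul_mem (mul_mem hE hN') hg) (inv_mem hE)
  -- closure induction
  refine Subgroup.closure_induction (p := fun M _ ↦ A⁻¹ * M * A ∈ relE I₁ I₂) ?_ ?_ ?_ ?_ hM
  · rintro g (⟨x, hx, rfl⟩ | ⟨y, hy, rfl⟩)
    · obtain ⟨I', hI', hI'I, hB⟩ := exists_forall_relG_conj_mem hm
        (SpecialLinearGroup.map (algebraMap (Localization.Away (m : ℤ)) (FractionRing (Localization.Away (m : ℤ)))) (e12 x)) hI
      exact hgen (e12 x) (e12_mem_relE hx) (fun _ ↦ rfl) I' hI' hI'I hB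
    · obtain ⟨I', hI', hI'I, hB⟩ := exists_forall_relG_conj_mem hm
        (SpecialLinearGroup.map (algebraMap (Localization.Away (m : ℤ)) (FractionRing (Localization.Away (m : ℤ)))) (e21 y)) hI
      exact hgen (e21 y) (e21_mem_relE hy) (fun _ ↦ rfl) I' hI' hI'I hB
  · simp
  · intro M N _ _ hM hN
    have e : A⁻¹ * (M * N) * A = (A⁻¹ * M * A) * (A⁻¹ * N * A) := by group
    rw [e]; exact mul_mem hM hN
  · intro M _ hM
    have e : A⁻¹ * M⁻¹ * A = (A⁻¹ * M * A)⁻¹ := by group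
    rw [e]; exact inv_mem hM

/-- The same with `A M A⁻¹`. [cite: Vaserstein1972SL2, p. 314] -/
theorem conj_mem_relE_of_mem_relG' (hm : 2 ≤ m) {I₁ I₂ : Ideal (Localization.Away (m : ℤ))} (hI₁ : I₁ ≠ ⊥)
    (hI₂ : I₂ ≠ ⊥) {A : SL(2, Localization.Away (m : ℤ))} (hA : A ∈ relG I₁ I₂) {M : SL(2, Localization.Away (m : ℤ))}
    (hM : M ∈ relE I₁ I₂) : A * M * A⁻¹ ∈ relE I₁ I₂ := by
  simpa using conj_mem_relE_of_mem_relG hm hI₁ hI₂ (inv_mem hA) hM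

/-- `E(I₁, I₂)` as a subgroup of `G(I₁, I₂)` is normal. [cite: Vaserstein1972SL2, p. 314] -/
theorem relE_subgroupOf_relG_normal (hm : 2 ≤ m) {I₁ I₂ : Ideal (Localization.Away (m : ℤ))} (hI₁ : I₁ ≠ ⊥)
    (hI₂ : I₂ ≠ ⊥) : ((relE I₁ I₂).subgroupOf (relG I₁ I₂)).Normal := by
  refine ⟨fun M hM A ↦ ?_⟩
  rw [Subgroup.mem_subgroupOf] at hM ⊢
  simpa using conj_mem_relE_of_mem_relG' hm hI₁ hI₂ A.prop hM

end Lemma2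

end Away

end SL2Rel

end Literature.NumberTheory.Automorphic
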